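import Literature.Probability.LatticeModels.AnnealedDeviceCorr
import HarnessLib

/-!
# Crux DeviceWeylUniversality (stmt-CriticalPhenomena-4722), line `birth` — stub `stub_deviceOdd` (D1)

Route `ConformalPoissonDevice`, sub-problem `Ising3DConformalLimit`; stub D1 of the skeleton of the
line `birth`: **against polynomially bounded constants, the odd annealed device correlators die.**

The device of the route is the Poisson process on `ℝ³` of intensity
`ν_N = N (1 + ‖z‖²)⁻³ dz`, of finite total mass `N · I`, `I = ∫ (1 + ‖z‖²)⁻³ dz ∈ (0, ∞)`
(`I = π²/4`, not needed), carrying the free zero-field finite-volume Ising model on its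
pencil-rule graph. For ODD `n` the spin flip kills every non-empty configuration and the empty
configuration contributes `1`, so the annealed correlator is the void probability
`annealedDeviceCorr (P N) β n x = e^{-ν_N(ℝ³)} = e^{-N I}` (tree theorem
`annealedDeviceCorr_of_odd_of_isPoissonPointProcess`, Last–Penrose 2017, Def. 3.1 at `k = 0`).
Hence for `|c_N| ≤ (N+1)^K`: `|c_N^n e^{-N I}| ≤ (N+1)^{Kn} e^{-N I} → 0`, and since the value
does not depend on `x` the convergence is uniform, a fortiori locally uniform on
`NonCoincident 3 n`.

Sources: tree API `Literature/Probability/LatticeModels/AnnealedDeviceCorr.lean`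
(`annealedDeviceCorr_of_odd_of_isPoissonPointProcess`); Mathlib
`integrable_rpow_neg_one_add_norm_sq` (finiteness of `I`),
`Real.tendsto_pow_mul_exp_neg_atTop_nhds_zero`, `Filter.Tendsto.tendstoUniformlyOn_const`.
-/

noncomputable section

open Filter Topology MeasureTheory
open scoped ENNReal
open Literature.Probability.LatticeModels Literature.Analysis.FunctionSpaces

namespace Summit.CriticalPhenomena.Ising3DConformalLimit.Theorems.DeviceWeylUniversality

namespace StubDeviceOdd

/-- The conformal density `(1 + ‖z‖²)⁻³` has finite Lebesgue integral over `ℝ³`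
(`6 > 3 = dim`). [folklore] -/
theorem deviceOdd_lintegral_lt_top :
    (∫⁻ z : EuclideanSpace ℝ (Fin 3), ENNReal.ofReal ((1 + ‖z‖ ^ 2) ^ (-(3:ℝ)))) < ∞ := by
  have h : Integrable (fun z : EuclideanSpace ℝ (Fin 3) => ((1:ℝ) + ‖z‖ ^ 2) ^ (-(6:ℝ) / 2))
      (volume : Measure (EuclideanSpace ℝ (Fin 3))) :=
    integrable_rpow_neg_one_add_norm_sq (by rw [finrank_euclideanSpace_fin]; norm_num)
  have h6 : (-(6:ℝ) / 2) = -(3:ℝ) := by norm_num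
  rw [h6] at h
  exact (hasFiniteIntegral_iff_ofReal (Eventually.of_forall fun z => by positivity)).1
    h.hasFiniteIntegral

/-- The conformal density `(1 + ‖z‖²)⁻³` is everywhere positive, so its Lebesgue integral over
`ℝ³` is non-zero. [folklore] -/
theorem deviceOdd_lintegral_ne_zero :
    (∫⁻ z : EuclideanSpace ℝ (Fin 3), ENNReal.ofReal ((1 + ‖z‖ ^ 2) ^ (-(3:ℝ)))) ≠ 0 := by
  have hf : Measurable fun z : EuclideanSpace ℝ (Fin 3) =>
      ENNReal.ofReal ((1 + ‖z‖ ^ 2) ^ (-(3:ℝ))) := by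
    fun_prop
  refine ((lintegral_pos_iff_support hf).2 ?_).ne'
  refine (Measure.measure_univ_pos.mpr (NeZero.ne volume)).trans_le (measure_mono fun z _ => ?_)
  exact (ENNReal.ofReal_pos.2 (Real.rpow_pos_of_pos (by positivity) _)).ne'

/-- Total mass of the device intensity: `ν_N(ℝ³) = N · ∫ (1 + ‖z‖²)⁻³ dz`. [folklore] -/
theorem deviceOdd_intensity_univ (N : ℕ) :
    ((N : ENNReal) • (MeasureTheory.volume : MeasureTheory.Measure
      (EuclideanSpace ℝ (Fin 3))).withDensity
        (fun z => ENNReal.ofReal ((1 + ‖z‖ ^ 2) ^ (-(3:ℝ))))) Set.univ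
      = (N : ENNReal) *
        ∫⁻ z : EuclideanSpace ℝ (Fin 3), ENNReal.ofReal ((1 + ‖z‖ ^ 2) ^ (-(3:ℝ))) := by
  rw [Measure.smul_apply, withDensity_apply _ MeasurableSet.univ, Measure.restrict_univ,
    smul_eq_mul]

/-- The device intensity `ν_N = N (1 + ‖z‖²)⁻³ dz` is a finite measure on `ℝ³`. [folklore] -/
theorem deviceOdd_isFiniteMeasure (N : ℕ) :
    IsFiniteMeasure ((N : ENNReal) • (MeasureTheory.volume : MeasureTheory.Measure
      (EuclideanSpace ℝ (Fin 3))).withDensity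
        (fun z => ENNReal.ofReal ((1 + ‖z‖ ^ 2) ^ (-(3:ℝ))))) := by
  refine ⟨?_⟩
  rw [deviceOdd_intensity_univ]
  exact ENNReal.mul_lt_top (ENNReal.natCast_lt_top N) deviceOdd_lintegral_lt_top

/-- Polynomial times decaying exponential along the naturals: `(N+1)^m e^{-N a} → 0` for `a > 0`.
[folklore] -/
theorem deviceOdd_tendsto_pow_mul_exp {a : ℝ} (ha : 0 < a) (m : ℕ) :
    Tendsto (fun N : ℕ => ((N:ℝ) + 1) ^ m * Real.exp (-((N:ℝ) * a))) atTop (𝓝 0) := by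
  have hy : Tendsto (fun N : ℕ => a * ((N:ℝ) + 1)) atTop atTop :=
    (tendsto_atTop_add_const_right _ 1 tendsto_natCast_atTop_atTop).const_mul_atTop ha
  have h := ((Real.tendsto_pow_mul_exp_neg_atTop_nhds_zero m).comp hy).const_mul
    (Real.exp a / a ^ m)
  rw [mul_zero] at h
  refine h.congr fun N => ?_
  have hexp : Real.exp (-(a * ((N:ℝ) + 1))) = Real.exp (-((N:ℝ) * a)) * (Real.exp a)⁻¹ := by
    rw [← Real.exp_neg a, ← Real.exp_add]
    congr 1
    ring
  simp only [Function.comp_def]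
  rw [hexp, mul_pow]
  field_simp

/-- Squeeze: for `|c_N| ≤ (N+1)^K` and `a > 0`, `c_N^n e^{-N a} → 0`. [folklore] -/
theorem deviceOdd_tendsto_main {a : ℝ} (ha : 0 < a) {c : ℕ → ℝ} {K : ℕ}
    (hc : ∀ N : ℕ, |c N| ≤ ((N : ℝ) + 1) ^ K) (n : ℕ) :
    Tendsto (fun N : ℕ => c N ^ n * Real.exp (-((N:ℝ) * a))) atTop (𝓝 0) := by
  refine squeeze_zero_norm (fun N => ?_) (deviceOdd_tendsto_pow_mul_exp ha (K * n))
  rw [Real.norm_eq_abs, abs_mul, abs_pow, Real.abs_exp, pow_mul]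
  gcongr
  exact hc N

end StubDeviceOdd

open StubDeviceOdd in
/-- **Stub D1 — odd device correlators die against polynomial constants.** For the route's
Poisson laws `P N` of intensity `ν_N = N (1 + ‖z‖²)⁻³ dz` on `ℝ³` (finite total mass `N · I`,
`0 < I = ∫ (1 + ‖z‖²)⁻³ dz < ∞`), every `β`, constants `|c_N| ≤ (N+1)^K` and ODD `n`: the
annealed device correlator is the void probability `e^{-N I}` (spin flip kills every non-empty
configuration, the empty one contributes `1`; Last–Penrose 2017, Def. 3.1 at `k = 0`), so
`c_N^n · annealedDeviceCorr (P N) β n → 0` uniformly in `x`, hence locally uniformly on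
`NonCoincident 3 n`. [cite: LastPenrose2017, Def 3.1] -/
theorem stub_deviceOdd :
    ∀ (P : ℕ → MeasureTheory.Measure
      (Literature.Analysis.FunctionSpaces.PointConfig (EuclideanSpace ℝ (Fin 3)))),
    (∀ N : ℕ, Literature.Analysis.FunctionSpaces.IsPoissonPointProcess ((N : ENNReal) •
      (MeasureTheory.volume : MeasureTheory.Measure (EuclideanSpace ℝ (Fin 3))).withDensity
        (fun z => ENNReal.ofReal ((1 + ‖z‖ ^ 2) ^ (-(3:ℝ))))) (P N))
    → ∀ (β : ℝ) (c : ℕ → ℝ) (K : ℕ), (∀ N : ℕ, |c N| ≤ ((N : ℝ) + 1) ^ K)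
    → ∀ n : ℕ, Odd n → TendstoLocallyUniformlyOn
        (fun (N : ℕ) (x : Fin n → EuclideanSpace ℝ (Fin 3)) => c N ^ n *
          Literature.Probability.LatticeModels.annealedDeviceCorr (P N) β n x)
        (fun _ => 0) Filter.atTop (Literature.Probability.LatticeModels.NonCoincident 3 n) := by
  intro P hP β c K hc n hn
  set I : ℝ≥0∞ := ∫⁻ z : EuclideanSpace ℝ (Fin 3), ENNReal.ofReal ((1 + ‖z‖ ^ 2) ^ (-(3:ℝ)))
  have hIpos : 0 < I.toReal :=
    ENNReal.toReal_pos deviceOdd_lintegral_ne_zero deviceOdd_lintegral_lt_top.ne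
  have hF : ∀ (N : ℕ) (x : Fin n → EuclideanSpace ℝ (Fin 3)),
      annealedDeviceCorr (P N) β n x = Real.exp (-((N:ℝ) * I.toReal)) := by
    intro N x
    haveI := deviceOdd_isFiniteMeasure N
    rw [annealedDeviceCorr_of_odd_of_isPoissonPointProcess (hP N) β hn x,
      deviceOdd_intensity_univ, ENNReal.toReal_mul, ENNReal.toReal_natCast]
  have hfun : (fun (N : ℕ) (x : Fin n → EuclideanSpace ℝ (Fin 3)) =>
      c N ^ n * annealedDeviceCorr (P N) β n x)
      = fun N _ => c N ^ n * Real.exp (-((N:ℝ) * I.toReal)) := by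
    funext N x
    rw [hF]
  rw [hfun]
  exact ((deviceOdd_tendsto_main hIpos hc n).tendstoUniformlyOn_const _).tendstoLocallyUniformlyOn

end Summit.CriticalPhenomena.Ising3DConformalLimit.Theorems.DeviceWeylUniversality

end
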